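import Summits.QuantumFields.BalabanUV.T4Continuum.Support.B13TermData
import Mathlib.MeasureTheory.Integral.Prod

/-!
# NE5 ∕ U3 — O1-d2-ii «act instance», part 1: PARAMETRISED (2.14)-TERM CORES.  One resummed term of [Balaban1988RG2Cluster] (2.14) p. 15 is a
# CONTOUR INTEGRAL `∫ w(p)·T_p(o,h) dλ(p)` of route P2's term data over the decoupling parameters `p = (s, σ, t, τ)`; the activity slot
# `actPar` of the model of record, and this row's exp-linear STRUCTURE for it by Fubini (row O1-d2-ii, booked to the leaf-08 lineage by the
# owner, journal l.9680 (R-a); finding + plan l.9790)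

Cell `pub-balaban`, unit `b2b-balaban-t4-ne5-formalise-leaf-08` (NE5 formalisation swarm, LEAF PROVER 08, gen 2; rows O1-d2 ∕ O1-d2-ii).  Summits-side
NEW WORK under the LEAN PLACEMENT RULE (cell modelling + bookkeeping; NOT a Literature module).  HONEST FRAMING: rung (B)+1 of the FINITE-VOLUME
T⁴ continuum programme — NOT infinite volume, NOT a mass gap, NOT the Clay problem, NOT a proof of NE5 (NOT PRINTED; cell GAPS G-t4-U3-1).  HONEST
DEPENDENCY (cell line, verbatim): continuum YM on T⁴ ⇐ BetaPertH ∧ nine spine estimates (0/9 proved); BetaPertH ⇐ (D1) ∧ (D4) ∧ CAP+tail;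
G-an2-4 gates asym, D1 and NE2/3/4.

THE FINDING THIS FILE ANSWERS (journal l.9790; verbatim source = the owner's `b13-loci.md` l.36, render p015 ×2).  (2.14) reads
`Π_{Δ⊂Z∖Z′₀} ∫₀¹ds(Δ) (2πi)⁻¹∮ dσ(Δ)(σ(Δ) − s(Δ))⁻² · Π_{Y∈𝐃} ∫₀¹dt(Y) (2πi)⁻¹∮ dτ(Y)(τ(Y) − t(Y))⁻² · [a normalised Gaussian double integral whose
covariance C^{(k)}(Z₀, σ(Z)) and Γ_k(Z₀, σ(Z)) depend on the integration variables σ(Δ) and whose last factor exp[Σ_Y τ(Y)𝐕_k(Y, B)] carries the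
integration variables τ(Y)]`.  Route P2's `ActivityTermDatum.TermDatum` reads its Gaussian kernels `kP∕kA∕kL` ONCE per datum and FIXES `τ : 𝒴 → ℂ`;
hence a `TermDatum` is the (2.14)-integrand AT FIXED contour parameters, and one resummed term is an integral over a PARAMETRISED FAMILY of term
data.  The term-format slots of `B13TermData`∕`B13StepOfRecordTermData` (p212301∕p212552) are the sub-case «no parameters».
* §1 `ParamCore P dom T κ ι Ω Ω₀ 𝒞 PΛ` — ONE (2.14)-term's core with a parameter space: measure `lam` on `PΛ` (σ-finite), Cauchy weight
  `w : PΛ → ℂ` (measurable, bounded by `wB`), per-parameter Gaussian SLOT `slot : PΛ → T` and contour weights `τ : PΛ → 𝒴 → ℂ` (measurable in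
  `p`, moduli bounded by a radius letter `rad Y` — on print's circles the modulus is constant), the label bookkeeping, MEASURABLE field maps,
  ONE flat reference measure `ν` on `Ω` (σ-finite; route P2's convention — the Gaussian densities sit in `opForm`), a JOINTLY measurable untilted
  integrand `F₀ : PΛ → Ω → ℂ`, the Gaussian variables and the normalisation data; `datum 𝔠 F G ϱ p : TermDatum …` (the P2 datum at parameter `p`:
  kernels `entry F o (Species.• (slot p) …)`, `τ := τ p`, `read := readVpp`, `v Y := ϱ·rad Y·level136 (d (dom Y))`); `histL` (p-INDEPENDENT history
  functionals); **`actPar F G rH 𝔗 Z j o h := ∫ p, w p * (datum … p).term (o, h) ∂lam`** — THE RESUMMED TERM.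
* §2 per parameter, BY CONSTRUCTION (leaf-06∕07 BY NAME, as part 1): `read_datum`, `readUnitBound_datum` (P2's `ReadUnitBound` with the radius
  weights, uniform in `p`), `histForm_datum` (the history exponent is `Σ_{Y∈D} τ p Y · readVpp … h Y x`, jointly measurable in `(p, x)`),
  `norm_histCLM_datum_le` (`‖Λ_p(x)‖ ≤ Σ_{Y∈D} rad Y·level136 (d (dom Y))`, uniform in `p`).
* §3 **`actExpLinearOn_actPar`** — this row's STRUCTURE `ActExpLinearOn 𝒯 (actPar …) (dataPar …) K W` for ANY term indexing over `C.Dom` and ANY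
  class, with data (λ.prod ν, `(p, x) ↦ w p·z_p(o)⁻¹·e^{−opForm_p o x}·F₀ p x`, `(p, x) ↦ Λ_p(x)`), from EXACTLY ONE displayed one-run binder
  `refFPar`: integrability of `(p, x) ↦ w p·z_p(q.1)⁻¹·F_p q x` on `lam.prod ν` at the class points (the parametrised form of P2's `RefAt.hF`,
  (2.15) p. 15 KIND — the contour integrals are part of the one-run integrability there); the representation clause is Fubini
  (`MeasureTheory.integral_prod`) on top of part 1's `term_eq_integral_weight_cexp` per parameter; hence `termHistExpLinear_actPar`,
  `termHistLineAnalytic_actPar` (leaf L04's history STRUCTURE for the parametrised slot) by p207797's generic theorems.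
WHAT IS NOT HERE (parts /2–/5 of the plan): the CONCRETE parameter spaces (cubes of Z∖Z′₀, 𝐃, the circles e^{κ₁} and (2.18)), the concrete
Gaussian cores (flat ν on the fields of Z, Z₀; `F₀ = (−1)^{|P|}χ_{k,Y₀}χ^c_{k,P}`), the slot type `(Z₀, σ-configuration)` and the species of record
(rows NE2∕NE3), the per-core operator holomorphy; no estimate of [II] is proved or asserted.  0 sorry; axioms ⊆ {propext, Classical.choice, Quot.sound}.
-/

noncomputable section

open MeasureTheory
open scoped BigOperators

namespace Summit.QuantumFields.BalabanUV.T4Continuum.B13TermParam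

open Literature.MathematicalPhysics.QuantumFieldTheory.Balaban1983to89
open Literature.MathematicalPhysics.QuantumFieldTheory.Balaban1983to89.T4OutputRate (Carriers)
open Literature.MathematicalPhysics.QuantumFieldTheory.Balaban1983to89.T4InputCauchyRateTermwise (TermHistExpLinear TermHistLineAnalytic)
open Literature.MathematicalPhysics.QuantumFieldTheory.Balaban1983to89.T4ActivityTiltHistory (ReadUnitBound histPot)
open Summit.QuantumFields.BalabanUV.T4Continuum.ActivityTermModel (TermDatum)
open Summit.QuantumFields.BalabanUV.T4Continuum.B13OpDatum (Format OpDatum entry Species B13Weights)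
open Summit.QuantumFields.BalabanUV.T4Continuum.B13HistDatum (level136 level136_pos)
open Summit.QuantumFields.BalabanUV.T4Continuum.B13HistMeasurable (MeasPotFrame B13HistM)
open Summit.QuantumFields.BalabanUV.T4Continuum.B13HistReadout (readVpp VppCLMM readVpp_eq_clm readUnitBound_readVpp measurable_readVpp)
open Summit.QuantumFields.BalabanUV.T4Continuum.B13StepTermFamily
  (TermIndexing ActData ActExpLinearOn term tupleMeasure tupleWeight tupleFunctional termHistExpLinear_of_actExpLinear
    termHistLineAnalytic_of_actExpLinear)
open Summit.QuantumFields.BalabanUV.T4Continuum.B13StepTermExpLinear (histCLM histCLM_apply weight term_eq_integral_weight_cexp F_eq_mul_cexp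
  norm_histCLM_le norm_cexp_neg_histCLM_le)

/-! ## §1 Parametrised cores, the per-parameter P2 datum, the resummed term `actPar` -/

section Core

variable {C : Carriers} (P : MeasPotFrame C) {𝒴 : Type*} (dom : 𝒴 → C.Dom) (T κ ι Ω Ω₀ 𝒞 PΛ : Type*)
  [MeasurableSpace Ω] [MeasurableSpace Ω₀] [MeasurableSpace PΛ]

/-- [folklore] DATA (side conditions only, no estimate): THE CORE OF ONE RESUMMED (2.14)-TERM WITH ITS DECOUPLING PARAMETERS.  `lam` = the
measure of the contour∕segment parameters `p = (s, σ, t, τ)` ((1.22)∕(2.18) circles × [0,1] segments — concrete in part /2), `w` = the Cauchy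
weight `Π(2πi)⁻¹(σ−s)⁻²·Π(2πi)⁻¹(τ−t)⁻²` (bounded on the contours), `slot p` = the Gaussian slot `(Z₀, σ(p))` read at parameter `p`, `τ p` = the
potentials' contour weights at `p` (moduli `≤ rad`), one FLAT reference measure `ν` for the Gaussian variables, the jointly measurable untilted
integrand `F₀ p x` ((2.14): `(−1)^{|P|}χ_{k,Y₀}χ^c_{k,P}` times the s,t-dependence — concrete in part /3), the normalisation data.
NAMED PARAMETERS of the instantiation. -/
structure ParamCore where
  /-- measure of the decoupling parameters -/
  lam : Measure PΛ
  sigmaFiniteLam : SigmaFinite lam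
  /-- Cauchy weight of the contours -/
  w : PΛ → ℂ
  measW : Measurable w
  /-- a bound of the Cauchy weight on the support of `lam` (everywhere, for simplicity) -/
  wB : ℝ
  norm_w_le : ∀ p, ‖w p‖ ≤ wB
  /-- the Gaussian slot at parameter `p` -/
  slot : PΛ → T
  /-- the contour weights `τ(Y)` at parameter `p` -/
  τ : PΛ → 𝒴 → ℂ
  measτ : ∀ Y, Measurable fun p => τ p Y
  /-- radius letters bounding the contour weights' moduli -/
  rad : 𝒴 → ℝ
  rad_nonneg : ∀ Y, 0 ≤ rad Y
  norm_τ_le : ∀ p Y, ‖τ p Y‖ ≤ rad Y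
  /-- history labels and their bookkeeping -/
  D : Finset 𝒴
  bonds : 𝒴 → Finset κ
  cubes : 𝒴 → Finset 𝒞
  cubes₀ : Finset 𝒞
  /-- the field configuration read by `𝐕″(Y, ·)`, measurable in the integration point -/
  B : (Y : 𝒴) → Ω → P.Arg (dom Y)
  measB : ∀ Y, Measurable (B Y)
  /-- the flat reference measure of the Gaussian variables -/
  ν : Measure Ω
  sigmaFinite : SigmaFinite ν
  /-- the untilted integrand, jointly measurable in (parameter, integration point) -/
  F₀ : PΛ → Ω → ℂ
  measF₀ : Measurable fun px : PΛ × Ω => F₀ px.1 px.2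
  Xf : Ω → ι → ℝ
  Bf : Ω → κ → ℝ
  ν₀ : Measure Ω₀
  φ₀ : Ω₀ → ℂ
  B₀f : Ω₀ → κ → ℝ

namespace ParamCore

variable {P dom T κ ι Ω Ω₀ 𝒞 PΛ} {S : Type*} (𝔠 : ParamCore P dom T κ ι Ω Ω₀ 𝒞 PΛ) (F : Format (Species T κ ι Ω 𝒴))
  (G : B13Weights κ ι S 𝒴) (ϱ : ℝ)

/-- [folklore] The p-INDEPENDENT history functionals of the core: `L Y x := 𝐕″(dom Y, B Y x)` on the measurable history space. -/
def histL : 𝒴 → Ω → (B13HistM P →L[ℂ] ℂ) := fun Y x => VppCLMM P (dom Y) (𝔠.B Y x)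

/-- [folklore] **ROUTE P2's TERM DATUM AT PARAMETER `p`**: kernels read at the slot `slot p` in the format `F`, contour weights `τ p`, history
read-out `readVpp`, `𝐕″`-format `v Y := ϱ·rad Y·level136 (d (dom Y))` (radius currency, uniform in `p`), integrand `F₀ p`. -/
def datum (p : PΛ) : TermDatum (OpDatum (Species T κ ι Ω 𝒴)) (B13HistM P) ι κ S Ω Ω₀ 𝒴 𝒞 where
  d := G.d
  p := G.p
  q := G.q
  kL o a' i := entry F o (.gammaConstituent (𝔠.slot p) a' i)
  kA o := Matrix.of fun i j => entry F o (.deltaKer (𝔠.slot p) i j)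
  kP o := Matrix.of fun a' a'' => entry F o (.cov (𝔠.slot p) a' a'')
  D := 𝔠.D
  bonds := 𝔠.bonds
  cubes := 𝔠.cubes
  cubes₀ := 𝔠.cubes₀
  τ := 𝔠.τ p
  kQ o x Y b b' := entry F o (.potQ x Y b b')
  kR o x Y := entry F o (.potR x Y)
  w := G.w
  kk := G.kk
  v Y := ϱ * (𝔠.rad Y * level136 P.consts (C.d (dom Y)))
  read := readVpp P dom 𝔠.B
  ν := 𝔠.ν
  F₀ := 𝔠.F₀ p
  Xf := 𝔠.Xf
  Bf := 𝔠.Bf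
  ν₀ := 𝔠.ν₀
  φ₀ := 𝔠.φ₀
  B₀f := 𝔠.B₀f

/-- [folklore] Fields of the datum (`rfl`). -/
@[simp] theorem datum_ν (p : PΛ) : (𝔠.datum F G ϱ p).ν = 𝔠.ν := rfl
/-- [folklore] -/ @[simp] theorem datum_D (p : PΛ) : (𝔠.datum F G ϱ p).D = 𝔠.D := rfl
/-- [folklore] -/ @[simp] theorem datum_τ (p : PΛ) : (𝔠.datum F G ϱ p).τ = 𝔠.τ p := rfl
/-- [folklore] -/ @[simp] theorem datum_read (p : PΛ) : (𝔠.datum F G ϱ p).read = readVpp P dom 𝔠.B := rfl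
/-- [folklore] -/
@[simp] theorem datum_v (p : PΛ) (Y : 𝒴) : (𝔠.datum F G ϱ p).v Y = ϱ * (𝔠.rad Y * level136 P.consts (C.d (dom Y))) := rfl

/-! ## §2 Per parameter, by construction -/

/-- [folklore] The history read-out IS the p-independent CLM family `histL` (leaf-06's `readVpp_eq_clm`). -/
theorem read_datum (p : PΛ) (h : B13HistM P) (Y : 𝒴) (x : Ω) : (𝔠.datum F G ϱ p).read h Y x = 𝔠.histL Y x h :=
  readVpp_eq_clm P dom 𝔠.B h Y x

variable {ϱ} in
/-- [folklore] **P2's `ReadUnitBound` AT EVERY PARAMETER with the RADIUS weights** (uniform in `p`): `‖τ p Y·read‖ ≤ ‖h‖∕ϱ·(ϱ·rad Y·level136)`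
from leaf-06's bound and `‖τ p Y‖ ≤ rad Y`. -/
theorem readUnitBound_datum (hϱ : 0 < ϱ) (p : PΛ) :
    ReadUnitBound (𝔠.datum F G ϱ p).read (𝔠.datum F G ϱ p).D (𝔠.datum F G ϱ p).τ (𝔠.datum F G ϱ p).v ϱ := by
  intro h Y hY x
  have h1 := readUnitBound_readVpp P dom 𝔠.B 𝔠.D (𝔠.τ p) hϱ h Y hY x
  refine h1.trans ?_
  show ‖h‖ / ϱ * (ϱ * (‖𝔠.τ p Y‖ * level136 P.consts (C.d (dom Y)))) ≤ ‖h‖ / ϱ * (ϱ * (𝔠.rad Y * level136 P.consts (C.d (dom Y))))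
  have hl : 0 ≤ level136 P.consts (C.d (dom Y)) := (level136_pos P.pos _).le
  gcongr
  exact 𝔠.norm_τ_le p Y

variable {ϱ} in
/-- [folklore] The `v`-format is nonnegative. -/
theorem v_nonneg_datum (hϱ : 0 ≤ ϱ) (p : PΛ) (Y : 𝒴) : 0 ≤ (𝔠.datum F G ϱ p).v Y :=
  mul_nonneg hϱ (mul_nonneg (𝔠.rad_nonneg Y) (level136_pos P.pos _).le)

/-- [folklore] The history exponent at parameter `p`: `histForm y x = Σ_{Y∈D} τ p Y · readVpp … y Y x`. -/
theorem histForm_datum (p : PΛ) (y : B13HistM P) (x : Ω) :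
    (𝔠.datum F G ϱ p).histForm y x = ∑ Y ∈ 𝔠.D, 𝔠.τ p Y * readVpp P dom 𝔠.B y Y x := rfl

/-- [folklore] **JOINT MEASURABILITY of the history exponent in (parameter, integration point)** for every measurable table (τ measurable
in `p`, leaf-06's `measurable_readVpp` in `x`). -/
theorem measurable_histForm (y : B13HistM P) :
    Measurable fun px : PΛ × Ω => (𝔠.datum F G ϱ px.1).histForm y px.2 := by
  simp only [histForm_datum]
  exact Finset.measurable_sum _ fun Y _ =>
    ((𝔠.measτ Y).comp measurable_fst).mul ((measurable_readVpp P dom 𝔠.B 𝔠.measB y Y).comp measurable_snd)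

variable {ϱ} in
/-- [folklore] **THE HISTORY FUNCTIONAL IS BOUNDED UNIFORMLY IN THE PARAMETER**: `‖Λ_p(x)‖ ≤ Σ_{Y∈D} rad Y·level136 (d (dom Y))`
(part 1's `norm_histCLM_le` at parameter `p`, the margin cancelled). -/
theorem norm_histCLM_datum_le (hϱ : 0 < ϱ) (p : PΛ) (x : Ω) :
    ‖histCLM (𝔠.datum F G ϱ p) 𝔠.histL x‖ ≤ ∑ Y ∈ 𝔠.D, 𝔠.rad Y * level136 P.consts (C.d (dom Y)) := by
  have h := norm_histCLM_le (𝔱 := 𝔠.datum F G ϱ p) (L := 𝔠.histL) (𝔠.read_datum F G ϱ p) hϱ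
    (fun Y _ => 𝔠.v_nonneg_datum F G hϱ.le p Y) (𝔠.readUnitBound_datum F G hϱ p) x
  refine h.trans (le_of_eq ?_)
  simp only [datum_D, datum_v, ← Finset.mul_sum]
  rw [mul_div_cancel_left₀ _ hϱ.ne']

end ParamCore

/-! ## §1 (cont.) The family over the carriers' domains and the resummed activity `actPar` -/

variable {P dom T κ ι Ω Ω₀ 𝒞 PΛ} {S J : Type*} [Fintype ι] [Fintype κ] [DecidableEq ι] [DecidableEq κ]

/-- [folklore] **THE RESUMMED (2.14)-TERM**: `actPar F G rH 𝔗 Z j o h := ∫ p, w p · (datum p).term (o, h) ∂lam` — the contour∕segment integral of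
route P2's terms over the core's parameters, in the format, weights and margin of the polymer's scale. -/
def actPar (F : ℕ → Format (Species T κ ι Ω 𝒴)) (G : ℕ → B13Weights κ ι S 𝒴) (rH : ℕ → ℝ)
    (𝔗 : C.Dom → J → ParamCore P dom T κ ι Ω Ω₀ 𝒞 PΛ) : C.Dom → J → OpDatum (Species T κ ι Ω 𝒴) → B13HistM P → ℂ :=
  fun Z j o h => ∫ p, (𝔗 Z j).w p * ((𝔗 Z j).datum (F (C.scale Z)) (G (C.scale Z)) (rH (C.scale Z)) p).term (o, h) ∂(𝔗 Z j).lam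

/-- [folklore] THE EXHIBITED EXP-LINEAR DATA of the parametrised family: per `(Z, j)` the PRODUCT measure `lam ⊗ ν`, the weight
`(p, x) ↦ w p · weight_p o x` (part 1's history-free weight at parameter `p`), the functional `(p, x) ↦ Λ_p(x)`. -/
def dataPar (F : ℕ → Format (Species T κ ι Ω 𝒴)) (G : ℕ → B13Weights κ ι S 𝒴) (rH : ℕ → ℝ)
    (𝔗 : C.Dom → J → ParamCore P dom T κ ι Ω Ω₀ 𝒞 PΛ) : ActData C.Dom J (OpDatum (Species T κ ι Ω 𝒴)) (B13HistM P) (PΛ × Ω) where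
  ν Z j _ := (𝔗 Z j).lam.prod (𝔗 Z j).ν
  Φ Z j o px := (𝔗 Z j).w px.1 * weight ((𝔗 Z j).datum (F (C.scale Z)) (G (C.scale Z)) (rH (C.scale Z)) px.1) o px.2
  Λ Z j _ px := histCLM ((𝔗 Z j).datum (F (C.scale Z)) (G (C.scale Z)) (rH (C.scale Z)) px.1) (𝔗 Z j).histL px.2

/-! ## §3 This row's structure for the parametrised slot, by Fubini -/

section Structure

variable {ιT : Type*} (𝒯 : TermIndexing C ιT C.Dom J) (F : ℕ → Format (Species T κ ι Ω 𝒴)) (G : ℕ → B13Weights κ ι S 𝒴) (rH : ℕ → ℝ)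
  (𝔗 : C.Dom → J → ParamCore P dom T κ ι Ω Ω₀ 𝒞 PΛ)
  {K : ℕ → (ℕ → ℝ) → C.BgB → Set (OpDatum (Species T κ ι Ω 𝒴) × B13HistM P)} {W : Set (ℕ → ℝ)}

/-! SECTION BINDERS (included below): positive margins `hrH`, and the ONE displayed one-run binder `refFPar` — at every class point `q` of step
`k`, for every factor `(Z, j)` of every tuple localizing at a step-`k` domain, the WEIGHTED NORMALISED TILTED INTEGRAND
`(p, x) ↦ w p · z_p(q.1)⁻¹ · F_p q x` is integrable on `lam ⊗ ν` (the parametrised form of route P2's `RefAt.hF` — the one-run integrability behind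
(2.15) p. 15 of [Balaban1988RG2Cluster], whose contour integrals are part of the term; KIND, locator only, asserted nowhere). -/
variable (hrH : ∀ k, 0 < rH k)
  (refFPar : ∀ k, ∀ g ∈ W, ∀ (U : C.BgB) (q : OpDatum (Species T κ ι Ω 𝒴) × B13HistM P), q ∈ K k g U →
    ∀ X : C.Dom, C.scale X = k → ∀ i, 𝒯.Rel k i X → ∀ m,
      Integrable (fun px : PΛ × Ω => (𝔗 (𝒯.poly i m) (𝒯.lab i m)).w px.1 *
        ((((𝔗 (𝒯.poly i m) (𝒯.lab i m)).datum (F (C.scale (𝒯.poly i m))) (G (C.scale (𝒯.poly i m))) (rH (C.scale (𝒯.poly i m))) px.1).z q.1)⁻¹ *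
          ((𝔗 (𝒯.poly i m) (𝒯.lab i m)).datum (F (C.scale (𝒯.poly i m))) (G (C.scale (𝒯.poly i m))) (rH (C.scale (𝒯.poly i m))) px.1).F q px.2))
        ((𝔗 (𝒯.poly i m) (𝒯.lab i m)).lam.prod (𝔗 (𝒯.poly i m) (𝒯.lab i m)).ν))
include hrH refFPar

/-- [folklore] **THIS ROW's `ActExpLinearOn` FOR THE PARAMETRISED ACTIVITY SLOT** `actPar`, with the exhibited data `dataPar`, for ANY term
indexing over the carriers' domains and ANY class, from `hrH` + `refFPar` (the side conditions of the cores supply σ-finiteness and joint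
measurability; the representation clause is Fubini over `lam ⊗ ν` on top of part 1's per-parameter exp-linear form). -/
theorem actExpLinearOn_actPar : ActExpLinearOn 𝒯 (actPar F G rH 𝔗) (dataPar F G rH 𝔗) K W where
  sigmaFinite _ _ _ _ _ _ _ _ i _ m := by
    haveI := (𝔗 (𝒯.poly i m) (𝒯.lab i m)).sigmaFiniteLam
    haveI := (𝔗 (𝒯.poly i m) (𝒯.lab i m)).sigmaFinite
    show SigmaFinite ((𝔗 (𝒯.poly i m) (𝒯.lab i m)).lam.prod (𝔗 (𝒯.poly i m) (𝒯.lab i m)).ν)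
    infer_instance
  integrable k g hg U q hq X hX i hi m := by
    -- abbreviations
    set 𝔠 := 𝔗 (𝒯.poly i m) (𝒯.lab i m) with h𝔠
    set 𝔱 : PΛ → TermDatum (OpDatum (Species T κ ι Ω 𝒴)) (B13HistM P) ι κ S Ω Ω₀ 𝒴 𝒞 :=
      fun p => 𝔠.datum (F (C.scale (𝒯.poly i m))) (G (C.scale (𝒯.poly i m))) (rH (C.scale (𝒯.poly i m))) p with h𝔱
    have hF := refFPar k g hg U q hq X hX i hi m
    -- the un-tilting factor `exp(−Λ_p(x) q.2)` is jointly measurable and uniformly bounded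
    have hmeas : AEStronglyMeasurable (fun px : PΛ × Ω => Complex.exp (-(histCLM (𝔱 px.1) 𝔠.histL px.2 q.2))) (𝔠.lam.prod 𝔠.ν) := by
      have : (fun px : PΛ × Ω => Complex.exp (-(histCLM (𝔱 px.1) 𝔠.histL px.2 q.2))) =
          fun px => Complex.exp ((𝔱 px.1).histForm q.2 px.2) := by
        funext px
        rw [B13StepTermExpLinear.histForm_eq_neg_histCLM (𝔠.read_datum _ _ _ px.1)]
      rw [this]
      exact (Complex.measurable_exp.comp (𝔠.measurable_histForm _ _ _ q.2)).aestronglyMeasurable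
    have hbd : ∀ px : PΛ × Ω, ‖Complex.exp (-(histCLM (𝔱 px.1) 𝔠.histL px.2 q.2))‖ ≤
        Real.exp (‖q.2‖ * ((∑ Y ∈ (𝔱 px.1).D, (𝔱 px.1).v Y) / rH (C.scale (𝒯.poly i m)))) := fun px =>
      norm_cexp_neg_histCLM_le (𝔠.read_datum _ _ _ px.1) (hrH _) (fun Y _ => 𝔠.v_nonneg_datum _ _ (hrH _).le px.1 Y)
        (𝔠.readUnitBound_datum _ _ (hrH _) px.1) q.2 px.2
    have hbd' : ∀ᵐ px : PΛ × Ω ∂(𝔠.lam.prod 𝔠.ν), ‖Complex.exp (-(histCLM (𝔱 px.1) 𝔠.histL px.2 q.2))‖ ≤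
        Real.exp (‖q.2‖ * ((∑ Y ∈ 𝔠.D, rH (C.scale (𝒯.poly i m)) * (𝔠.rad Y * level136 P.consts (C.d (dom Y)))) /
          rH (C.scale (𝒯.poly i m)))) :=
      Filter.Eventually.of_forall fun px => by simpa [h𝔱] using hbd px
    have hprod := hF.bdd_mul hmeas hbd'
    refine (hprod.congr (Filter.Eventually.of_forall fun px => ?_))
    -- pointwise: exp(−Λ h)·(w·z⁻¹·F) = w·weight
    show Complex.exp (-(histCLM (𝔱 px.1) 𝔠.histL px.2 q.2)) * (𝔠.w px.1 * (((𝔱 px.1).z q.1)⁻¹ * (𝔱 px.1).F q px.2)) =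
      𝔠.w px.1 * weight (𝔱 px.1) q.1 px.2
    rw [weight, B13StepTermExpLinear.expOp_mul_F₀_eq (𝔠.read_datum _ _ _ px.1) q.1 q.2 px.2]
    ring
  measurable _ _ _ _ q _ _ _ i _ m y := by
    set 𝔠 := 𝔗 (𝒯.poly i m) (𝒯.lab i m) with h𝔠
    have hm : Measurable fun px : PΛ × Ω =>
        -((𝔠.datum (F (C.scale (𝒯.poly i m))) (G (C.scale (𝒯.poly i m))) (rH (C.scale (𝒯.poly i m))) px.1).histForm y px.2) :=
      (𝔠.measurable_histForm _ _ _ y).neg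
    refine (hm.aestronglyMeasurable).congr (Filter.Eventually.of_forall fun px => ?_)
    show -((𝔠.datum _ _ _ px.1).histForm y px.2) = histCLM (𝔠.datum _ _ _ px.1) 𝔠.histL px.2 y
    rw [B13StepTermExpLinear.histForm_eq_neg_histCLM (𝔠.read_datum _ _ _ px.1), neg_neg]
  bounded _ _ _ _ _ _ _ _ i _ m :=
    ⟨∑ Y ∈ (𝔗 (𝒯.poly i m) (𝒯.lab i m)).D, (𝔗 (𝒯.poly i m) (𝒯.lab i m)).rad Y * level136 P.consts (C.d (dom Y)),
      Filter.Eventually.of_forall fun px => (𝔗 (𝒯.poly i m) (𝒯.lab i m)).norm_histCLM_datum_le _ _ (hrH _) px.1 px.2⟩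
  repr k g hg U q hq X hX i hi m := by
    set 𝔠 := 𝔗 (𝒯.poly i m) (𝒯.lab i m) with h𝔠
    haveI := 𝔠.sigmaFiniteLam
    haveI := 𝔠.sigmaFinite
    -- the integrand of the representation is integrable on the product (it equals the displayed integrand pointwise)
    have hint : Integrable (fun px : PΛ × Ω => (dataPar F G rH 𝔗).Φ (𝒯.poly i m) (𝒯.lab i m) q.1 px *
        Complex.exp ((dataPar F G rH 𝔗).Λ (𝒯.poly i m) (𝒯.lab i m) q.1 px q.2)) (𝔠.lam.prod 𝔠.ν) := by
      refine (refFPar k g hg U q hq X hX i hi m).congr (Filter.Eventually.of_forall fun px => ?_)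
      show 𝔠.w px.1 * (((𝔠.datum _ _ _ px.1).z q.1)⁻¹ * (𝔠.datum _ _ _ px.1).F q px.2) =
        𝔠.w px.1 * weight (𝔠.datum _ _ _ px.1) q.1 px.2 * Complex.exp (histCLM (𝔠.datum _ _ _ px.1) 𝔠.histL px.2 q.2)
      rw [weight, F_eq_mul_cexp (𝔠.read_datum _ _ _ px.1) q.1 q.2 px.2]
      ring
    show actPar F G rH 𝔗 (𝒯.poly i m) (𝒯.lab i m) q.1 q.2 = ∫ px, (dataPar F G rH 𝔗).Φ (𝒯.poly i m) (𝒯.lab i m) q.1 px *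
      Complex.exp ((dataPar F G rH 𝔗).Λ (𝒯.poly i m) (𝒯.lab i m) q.1 px q.2) ∂(𝔠.lam.prod 𝔠.ν)
    rw [integral_prod _ hint, actPar]
    refine integral_congr_ae (Filter.Eventually.of_forall fun p => ?_)
    show 𝔠.w p * (𝔠.datum _ _ _ p).term (q.1, q.2) = ∫ x, 𝔠.w p * weight (𝔠.datum _ _ _ p) q.1 x *
      Complex.exp (histCLM (𝔠.datum _ _ _ p) 𝔠.histL x q.2) ∂𝔠.ν
    rw [term_eq_integral_weight_cexp (𝔠.read_datum _ _ _ p) q.1 q.2, ← integral_const_mul]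
    refine integral_congr_ae (Filter.Eventually.of_forall fun x => ?_)
    show 𝔠.w p * (weight (𝔠.datum _ _ _ p) q.1 x * Complex.exp (histCLM (𝔠.datum _ _ _ p) 𝔠.histL x q.2)) = _
    ring

/-- [folklore] **… HENCE `TermHistExpLinear` WITH EXHIBITED (μ, Φ, Λ)** for the Ursell term family on the PARAMETRISED slot (product measures of the
`lam ⊗ ν`, p207797 BY NAME). -/
theorem termHistExpLinear_actPar (inc : C.Dom → C.Dom → Prop) [DecidableRel inc] :
    TermHistExpLinear K (term 𝒯 inc (actPar F G rH 𝔗)) W (α := fun _ i => Fin (𝒯.len i + 1) → PΛ × Ω)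
      (fun _ i o _ => tupleMeasure 𝒯 (dataPar F G rH 𝔗) i o) (fun k i o X => tupleWeight 𝒯 inc (dataPar F G rH 𝔗) k i o X)
      (fun k i o X => tupleFunctional 𝒯 (dataPar F G rH 𝔗) k i o X) :=
  termHistExpLinear_of_actExpLinear (actExpLinearOn_actPar 𝒯 F G rH 𝔗 hrH refFPar)

/-- [folklore] **… AND `TermHistLineAnalytic`** for the parametrised slot (leaf L04's history half), no analyticity hypothesis. -/
theorem termHistLineAnalytic_actPar (inc : C.Dom → C.Dom → Prop) [DecidableRel inc] :
    TermHistLineAnalytic K (term 𝒯 inc (actPar F G rH 𝔗)) W :=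
  termHistLineAnalytic_of_actExpLinear (inc := inc) (actExpLinearOn_actPar 𝒯 F G rH 𝔗 hrH refFPar)

end Structure

end Core

end Summit.QuantumFields.BalabanUV.T4Continuum.B13TermParam

end
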